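import Literature.MathematicalPhysics.QuantumFieldTheory.Balaban1983to89.B9SmoothHolderClassPProducersR
import Literature.MathematicalPhysics.QuantumFieldTheory.Balaban1983to89.B9SmoothHolderClassPClosure
import Literature.MathematicalPhysics.QuantumFieldTheory.Balaban1983to89.B9Thm313WholeDvsFromDdAnyNorm

/-!
# `Balaban1983to89.B9Thm313WholeRDvsWordIntoBHZP` — [B9] Thm 3.13 p. 426 + (3.44)∕(3.45) p. 398 + (3.49) p. 399: THE WORD `R ∘ D\*_U ∘ T` INTO THE TRANSPORTED
# PRINT-WEIGHTED SITE CLASS `bHZP (taxiS U) s` FROM THE DIRECTION MEMBERS OF `T`, THE LETTERS `J†_ν` AND THE (3.49) WORDS OF `P` (programme P-HRGDD, leg (D) core)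

T. Bałaban, *Propagators for lattice gauge theories in a background field*, Commun. Math. Phys. **99** (1985) 389–434 [`Balaban1985BackgroundPropagators`];
[4] = T. Bałaban, *Propagators and renormalization transformations for lattice gauge theories. II*, Commun. Math. Phys. **96** (1984) 223–250 [`Balaban1984PropagatorsII`].
statement-level skeleton of published theorems with citation tags; proofs where landed; nothing here is a claim about the Yang–Mills mass gap.

WHY THIS FILE (cell `pub-ymgap`, node N06, bundle F7 rows 20–21, seat dag-n06-l g32; HOME `P-HRGDD-LEG-D-MEMO.md` §1 steps 2–5 at `KIdx` level).  The last displayed L-class letter of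
the rows-20–21 certificate, `hrgdd13` (`R ∘ D\*_U ∘ G₁ ∘ ∇\*_{U,μ}` from the one-parameter source class INTO the transported site class, print's LOSSY (3.45) species), is
`R ∘ D\*_U ∘ T` at `T := G₁∇\*_{U,μ}`.  ★★★ `hasMaj_R_dvs_comp_into_bHZP` assembles it from HYPOTHESES of exactly the shapes the programme's legs deliver:
(A) the direction members of `T` — per `ν`, a sup member INTO `𝔠^{(−1)}_{blkBK}` and an `s`-probe member INTO `𝔠_P^{(s−1)}` (`B9Thm313WholeG1PairMembersRegular` (iii)∕(iv) after the
certificate's unit shifts); (B) the letters `J†_ν` — class-to-class `bHZKP (taxiB U) s → bHZP (taxiS U) s` (dag-n06-c, `B9DivLetterTransportedInputClasses.hasMaj_JTcoKH_bHZKP_bHZP`) and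
sup-to-sup `𝔠^{(−1)}_{blkBK} → 𝔠^{(−1)}_{blkSK}`; the split `D\*_U = Σ_ν J†_ν ∘ ∇_{U,ν}` (`B9DivViaGradLettersAtPins.DvscoKH_eq_sum` at the pins); (3.49)'s words of `P`
(`hP`, `hDvP`) and `R = ϱ·(I − P)` (`hR`).  Chain: scalar `ϱ` rides on the members (`∇_ν ∘ (ϱT) = ϱ·(∇_ν ∘ T)`); closure INTO `bHZKP (taxiB U) s` per `ν`
(`B9SmoothHolderClassPClosure.hasMaj_into_bHZKP_of_probeMaj_near`); sum over `ν` through the letters (`B9Thm313WholeDvsFromDdAnyNorm.word_dvs_of_members`, class AND sup);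
`R`-step (`B9SmoothHolderClassPProducersR.hasMaj_R_comp_into_bHZP`, (3.49) + CTel).  Output: `HasMaj b₁ (bHZP (taxiS U) s) (R ∘ D\*_U ∘ T) (K_out·e^{−ρd})`, `K_out` CLOSED FORM
in the input constants (uniform in the member∕configuration: `|P|`, `1 + C_Lip`, `L`, `CTel`), rates `0 ≤ ρ ≤ ρ₁ ≤ δ_V`, `ρ₁ + σ ≤ δ_J`, `ρ + σ + αδ_F ≤ r_P`.
HONEST SCOPE.  Majorant algebra over cited closures; members, letters and (3.49) words are HYPOTHESES; nothing of [B9]∕[4] asserted; no pin, no certificate edit;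
COUNT-NEUTRAL; N06 NOT discharged; nothing continuum ∕ OS ∕ mass gap ∕ Clay.  NEW file; cell `pub-ymgap` (HUMAN RULING D-0062), Track A node N06 [B9], seat
`pub-ymgap-dag-n06-l` (g32), 2026-08-30.
-/

namespace Literature.MathematicalPhysics.QuantumFieldTheory.Balaban1983to89.B9Thm313WholeRDvsWordIntoBHZP

open B6Geom246MultiLevelTorus (geomT)
open B6GlobalChartV1 (PV blkV1)
open B6Ineq2142KLevelV1 (β lvl)
open B6KLevelCensusIndexV1 (KIdx)
open B6Prop22KLevelTorusCensusEta (nKT)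
open B9GeoNormsKLevelV1 (geo9K)
open B9Thm34Ext (toB6)
open B9Thm312Whole (GeoOK)
open B9Thm312WholeClasses (cNormR cNormR_κ)
open B9RWSums343to347Whole (Facts347)
open B11SectG (BlockNorm HasMaj RowSum)
open B9CoReadingCoords (XBK blkBK)
open B9CoReadingCoordsS (XSK sIK blkSK)
open B9CoReadingCoordsHolder (blkPK probeK wK w₀K)
open B9CoReadingCoordsHolderAdm (wKA)
open B9GradViaDivLettersTransported (taxiS taxiB)
open B9MultiscaleSmoothPartitionYNear (rNear)
open B9SmoothHolderClassP (bHZP bHZKP bHZKP_κ)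
open B9MultiscaleSmoothPartitionYLip (CLip CLip_nonneg)
open B9SmoothHolderClassPClosure (hasMaj_into_bHZKP_of_probeMaj_near)
open B9PerturbationMajorantAlgebra (hasMaj_smul_exp)
open B9SmoothHolderClassPProducers (CTel)
open B9SmoothHolderClassPProducersR (hasMaj_R_comp_into_bHZP)
open B9Thm313WholeDvsFromDdAnyNorm (word_dvs_of_members)
open Node00 (SiteY FBondY IBondY CfgY toKT)
open Node00.OpsYSectDCoords (DvcoKH)
open T4RelativeLadder (UnitaryLike)

noncomputable section

variable {d ℓ : ℕ} {hd : 1 ≤ d + 1} {hL : Odd (ℓ + 1) ∧ 1 < ℓ + 1} {b₀ b₁ : ℝ}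
variable {𝔸 : Type} [NormedRing 𝔸] [NormedAlgebra ℂ 𝔸] [CompleteSpace 𝔸] [FiniteDimensional ℝ 𝔸]
variable {κ : Type} [Fintype κ]
variable (i : KIdx d ℓ hd hL b₀ b₁) [Fintype (geo9K i).Site] (b : Module.Basis κ ℝ 𝔸)
variable (B : B9.Backgrounds) (cfg : B.Cfg → CfgY 𝔸 i) {R₀ : ℝ} {H₀ : Prop} {bI : FBondY i → IBondY i}
variable {dF : ℕ} {δF α L₀ σ c : ℝ}

/-- ★★★ **`R ∘ D\*_U ∘ T` INTO THE TRANSPORTED PRINT-WEIGHTED SITE CLASS `bHZP (taxiS U) s` FROM THE DIRECTION MEMBERS OF `T`, THE LETTERS `J†_ν`, AND (3.49)'s WORDS OF `P`**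
(programme P-HRGDD leg (D) at `KIdx` level; the certificate instantiates `T := G₁∇\*_{U,μ}`, `Dd ν := ∇_{U,ν}`, `JT ν := J†_ν`, `Dvs := D\*_U`, `P`, `R = ϱ(I − P)` at the pins).
For ANY source class `b₁` on a function carrier `V → ℝ` (the certificate's `bHK`∕`bHXA`) and `0 ≤ s ≤ 1`: (A) `hVsup`∕`hVpr` — per direction the sup member of `∇_ν ∘ T` INTO `𝔠^{(−1)}_{blkBK}` and its `s`-probe member INTO `𝔠_P^{(s−1)}`,
rate `δ_V`; (B) `hJT`∕`hJT0` — the letters `J†_ν` class-to-class (`bHZKP (taxiB U) s → bHZP (taxiS U) s`) and sup-to-sup (`𝔠^{(−1)}_{blkBK} → 𝔠^{(−1)}_{blkSK}`), rate `δ_J`;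
`hDvs` — the split `D\*_U = Σ_ν J†_ν ∘ ∇_ν`; `hP`∕`hDvP`∕`hR` — (3.49).  ⟹ `HasMaj b₁ (bHZP (taxiS U) s) (R ∘ D\*_U ∘ T) (K_out·e^{−ρd})` for `0 ≤ ρ ≤ ρ₁ ≤ δ_V`,
`ρ₁ + σ ≤ δ_J`, `ρ + σ + αδ_F ≤ r_P`, with the CLOSED-FORM `K_out = K_cl + CTel(ρ; C_P·L·K_sup·c, C_P·L·K_sup·c)`, `K_cl = |P|·(1 + C_Lip)·C_J·((L·|ϱ|C_V + L^{1−s}·|ϱ|C_{Vb})·e^{δ_V (r_near+1)})·c`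
(class channel: closure + letters + row sum), `K_sup = |P|·1·C_J⁰·|ϱ|C_V·c` (sup channel) — uniform in the member ∕ configuration.
[cite: Balaban1985BackgroundPropagators, Thm 3.13 (3.153) p.426 + (3.44)–(3.45) p.398 («B′₀(ε,β)») + (3.49) p.399 + (3.8) p.392; Balaban1984PropagatorsII, (2.51)–(2.56) pp.232–233 + Lemma 2.1 (2.61) p.234] -/
theorem hasMaj_R_dvs_comp_into_bHZP {s : ℝ} (hs0 : 0 ≤ s) (hs1 : s ≤ 1)
    (hG : GeoOK (geo9K i)) (hF : Facts347 (geo9K i) R₀ H₀ dF δF α L₀) (hrow : RowSum (toB6 (geo9K i) R₀ H₀) σ c)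
    (hβ1 : ∀ f : FBondY i, (geomT i.D).dist (β i.hN i.D i.hk (bI f)) (blkV1 i.hN i.D f) ≤ 1)
    (hlev : ∀ f : FBondY i, lvl i.hN i.D i.hk (bI f) = (blkV1 i.hN i.D f).1.1) (hbI0 : ∀ f : FBondY i, bI f = bI ⟨f.src, 0⟩)
    (hcf : |i.cf| = (nKT (toKT i) : ℝ)) {U : B.Cfg} (hU : ∀ ν x, UnitaryLike (cfg U ν x))
    {PI : Type} [Fintype PI]
    {P R : Module.End ℝ (XSK κ i → ℝ)} {Dvs : (XBK κ i → ℝ) →ₗ[ℝ] (XSK κ i → ℝ)} {Dd : PI → Module.End ℝ (XBK κ i → ℝ)}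
    {JT : PI → (XBK κ i → ℝ) →ₗ[ℝ] (XSK κ i → ℝ)}
    {V : Type} {b₁ : BlockNorm (toB6 (geo9K i) R₀ H₀) (V → ℝ)} {T : (V → ℝ) →ₗ[ℝ] (XBK κ i → ℝ)}
    {CP ϱ r CJ δJ CJ0 CV CVb δV ρ₁ ρ : ℝ}
    (hCP : 0 ≤ CP) (hCJ : 0 ≤ CJ) (hCJ0 : 0 ≤ CJ0) (hCV : 0 ≤ CV) (hCVb : 0 ≤ CVb) (hc : 0 ≤ c) (hδV : 0 ≤ δV)
    (hρ₁ : 0 ≤ ρ₁) (hρ₁V : ρ₁ ≤ δV) (hρ₁J : ρ₁ + σ ≤ δJ) (hρ : 0 ≤ ρ) (hρρ₁ : ρ ≤ ρ₁) (hbud : ρ + σ + α * δF ≤ r)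
    (hR : R = ϱ • (LinearMap.id - P)) (hDvs : Dvs = ∑ ν, JT ν ∘ₗ Dd ν)
    (hP : HasMaj (cNormR R₀ H₀ (blkSK i (sIK i bI)) hG.lenle 0) (cNormR R₀ H₀ (blkSK i (sIK i bI)) hG.lenle 0) P
      (fun a a' => CP * Real.exp (-(r * (geo9K i).dist a a'))))
    (hDvP : HasMaj (cNormR R₀ H₀ (blkSK i (sIK i bI)) hG.lenle 0) (cNormR R₀ H₀ (blkBK i bI) hG.lenle 1) (DvcoKH i b B cfg U ∘ₗ P)
      (fun a a' => CP * Real.exp (-(r * (geo9K i).dist a a'))))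
    (hJT : ∀ ν, HasMaj (bHZKP (κ := κ) i b (taxiB i B cfg U) (R := R₀) (H := H₀) (s := s) hs0 hs1)
      (bHZP (κ := κ) i b (taxiS i B cfg U) (R := R₀) (H := H₀) (s := s) hs0 hs1) (JT ν)
      (fun a a' => CJ * Real.exp (-(δJ * (geo9K i).dist a a'))))
    (hJT0 : ∀ ν, HasMaj (cNormR R₀ H₀ (blkBK i bI) hG.lenle (-1)) (cNormR R₀ H₀ (blkSK i (sIK i bI)) hG.lenle (-1)) (JT ν)
      (fun a a' => CJ0 * Real.exp (-(δJ * (geo9K i).dist a a'))))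
    (hVsup : ∀ ν, HasMaj b₁ (cNormR R₀ H₀ (blkBK i bI) hG.lenle (-1)) (Dd ν ∘ₗ T)
      (fun a a' => CV * Real.exp (-(δV * (geo9K i).dist a a'))))
    (hVpr : ∀ ν, HasMaj b₁ (cNormR R₀ H₀ (blkPK bI) hG.lenle (s - 1)) (probeK b (taxiB i B cfg U) (wKA i s) (w₀K i s) ∘ₗ (Dd ν ∘ₗ T))
      (fun a a' => CVb * Real.exp (-(δV * (geo9K i).dist a a')))) :
    HasMaj b₁ (bHZP (κ := κ) i b (taxiS i B cfg U) (R := R₀) (H := H₀) (s := s) hs0 hs1) (R ∘ₗ Dvs ∘ₗ T)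
      (fun a a' => ((Fintype.card PI : ℝ) * ((1 + CLip d ℓ) * CJ
          * ((((ℓ + 1 : ℕ) : ℝ) * (|ϱ| * CV) + (((ℓ + 1 : ℕ) : ℝ)) ^ (1 - s) * (|ϱ| * CVb)) * Real.exp (δV * (rNear d ℓ + 1))) * c)
        + CTel d ℓ b ρ (CP * (geo9K i).L * ((Fintype.card PI : ℝ) * (1 * CJ0 * (|ϱ| * CV) * c)) * c)
          (CP * (geo9K i).L * ((Fintype.card PI : ℝ) * (1 * CJ0 * (|ϱ| * CV) * c)) * c)) * Real.exp (-(ρ * (geo9K i).dist a a'))) := by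
  classical
  -- the scalar `ϱ` rides on the members: `∇_ν ∘ (ϱ•T) = ϱ•(∇_ν ∘ T)`
  have hsmul : ∀ ν, Dd ν ∘ₗ (ϱ • T) = ϱ • (Dd ν ∘ₗ T) := fun ν => by rw [LinearMap.comp_smul]
  have hsmulP : ∀ ν, probeK b (taxiB i B cfg U) (wKA i s) (w₀K i s) ∘ₗ (Dd ν ∘ₗ (ϱ • T))
      = ϱ • (probeK b (taxiB i B cfg U) (wKA i s) (w₀K i s) ∘ₗ (Dd ν ∘ₗ T)) := fun ν => by rw [hsmul, LinearMap.comp_smul]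
  have hV'sup : ∀ ν, HasMaj b₁ (cNormR R₀ H₀ (blkBK i bI) hG.lenle (-1)) (Dd ν ∘ₗ (ϱ • T))
      (fun a a' => |ϱ| * CV * Real.exp (-(δV * (geo9K i).dist a a'))) := fun ν => by
    rw [hsmul]; exact hasMaj_smul_exp (hVsup ν) ϱ
  have hV'pr : ∀ ν, HasMaj b₁ (cNormR R₀ H₀ (blkPK bI) hG.lenle (s - 1)) (probeK b (taxiB i B cfg U) (wKA i s) (w₀K i s) ∘ₗ (Dd ν ∘ₗ (ϱ • T)))
      (fun a a' => |ϱ| * CVb * Real.exp (-(δV * (geo9K i).dist a a'))) := fun ν => by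
    rw [hsmulP]; exact hasMaj_smul_exp (hVpr ν) ϱ
  -- closure INTO `bHZKP (taxiB U) s`, per direction
  have hϱV : 0 ≤ |ϱ| * CV := mul_nonneg (abs_nonneg _) hCV
  have hϱVb : 0 ≤ |ϱ| * CVb := mul_nonneg (abs_nonneg _) hCVb
  have hVcl : ∀ ν, HasMaj b₁ (bHZKP (κ := κ) i b (taxiB i B cfg U) (R := R₀) (H := H₀) (s := s) hs0 hs1) (Dd ν ∘ₗ (ϱ • T))
      (fun y y' => (((ℓ + 1 : ℕ) : ℝ) * (|ϱ| * CV) + (((ℓ + 1 : ℕ) : ℝ)) ^ (1 - s) * (|ϱ| * CVb)) * Real.exp (δV * (rNear d ℓ + 1))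
        * Real.exp (-(δV * (geo9K i).dist y y'))) := fun ν =>
    hasMaj_into_bHZKP_of_probeMaj_near i b (taxiB i B cfg U) hG.lenle hs0 hs1 hβ1 hlev hbI0 hδV hcf hϱV hϱVb
      (hV'sup ν) (hV'pr ν)
  -- the class member of `D\*_U ∘ (ϱ•T)` : sum over ν through the class letters
  have hCcl : 0 ≤ (((ℓ + 1 : ℕ) : ℝ) * (|ϱ| * CV) + (((ℓ + 1 : ℕ) : ℝ)) ^ (1 - s) * (|ϱ| * CVb)) * Real.exp (δV * (rNear d ℓ + 1)) := by
    positivity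
  have hYcl := word_dvs_of_members hG hrow (T := ϱ • T) hCcl hCJ hρ₁ hρ₁V hρ₁J le_rfl hDvs hVcl hJT
  -- the sup member of `D\*_U ∘ (ϱ•T)` : sum over ν through the sup letters
  have hYsup := word_dvs_of_members hG hrow (T := ϱ • T) hϱV hCJ0 hρ₁ hρ₁V hρ₁J le_rfl hDvs hV'sup hJT0
  rw [bHZKP_κ] at hYcl
  rw [cNormR_κ] at hYsup
  -- `D\*_U ∘ (ϱ•T) = ϱ•(D\*_U ∘ T)`
  rw [LinearMap.comp_smul] at hYcl hYsup
  -- the R-step (3.49) + CTel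
  have hKcl : 0 ≤ (Fintype.card PI : ℝ) * ((1 + CLip d ℓ) * CJ
      * ((((ℓ + 1 : ℕ) : ℝ) * (|ϱ| * CV) + (((ℓ + 1 : ℕ) : ℝ)) ^ (1 - s) * (|ϱ| * CVb)) * Real.exp (δV * (rNear d ℓ + 1))) * c) := by
    have := CLip_nonneg d ℓ
    positivity
  have hKsup : 0 ≤ (Fintype.card PI : ℝ) * (1 * CJ0 * (|ϱ| * CV) * c) := by positivity
  exact hasMaj_R_comp_into_bHZP i b B cfg hs0 hs1 hG hF hrow hβ1 hlev hcf hU hCP hKcl hKsup hc hρ hρρ₁ hbud hR hP hDvP hYcl hYsup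

end

end Literature.MathematicalPhysics.QuantumFieldTheory.Balaban1983to89.B9Thm313WholeRDvsWordIntoBHZP
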